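import Mathlib
import Summits.NavierStokesRegularity.NavierStokesRegularity.Theorems.ThreadingFluxAzimuthalCartanConicalWitnessEveryBall
import Summits.NavierStokesRegularity.NavierStokesRegularity.Theorems.ThreadingFluxAzimuthalCartanShellHomogeneousRigidity
import HarnessLib

/-!
# Crux `PoloidalLiouville` (stmt-NavierStokesRegularity-1222, wall W1), crux idea «azimuthal-cartan-test» (ns-idea-15 g10):
# WHERE LIOUVILLE CONE DATA CAN LIVE — on a full shell about the vertex the conical flow is Landau (or trivial)

Support file (`--supports stmt-NavierStokesRegularity-1222`, helper; cell `ns-wall-extremal`, width hand ns-wall-eng-6 g6, 0 kit).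

The conical correspondence (`LiouvilleCone.correspondence`, ns-wall-eng-6 g5, `…ConicalSteadyNS.lean`): Liouville data `LiouvilleCone U Φ g H`
on an open `U ∌ 0` give the real-analytic classical steady Navier–Stokes flow `conicalField Φ` on `U`, unthreaded and `(−1)`-homogeneous about
the vertex, with `curl u = (2e^{Φ}/|x|²)(∇Φ × x)`.  The K♯ witness (`…ConicalWitness*`, p719807/p721467) lives on a cone: it is singular on four
rays.  THIS FILE shows that this is forced — composition BY NAME of the correspondence with the homogeneous stratum of C♯
(`Homogeneous.landau_of_homogeneous`, ns-wall-eng-6 g4, `…ShellHomogeneousRigidity.lean`, itself over the tree's PROOF of Šverák's Theorem 1,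
`Literature.Analysis.FluidPDE.Sverak2011_landauClassification_holds`, series `SverakLandau*`, whose step 4 `SverakLandauObata` is the Obata-type
identity — a theorem of the tree, not a posited fact):

* `LiouvilleCone.grad_eq_zero_of_curl_eq_zero` — where the vorticity of the conical flow vanishes, so does `∇Φ` (`∇Φ × x = 0` and Euler
  `⟪x, ∇Φ⟫ = 0`; Lagrange's identity `|x|²|g|² = ⟪x, g⟫² + |g × x|²`);
* `LiouvilleCone.conicalField_eq_zero_of_curl` — if the vorticity vanishes on an open `W ⊆ U` then on `W`: `∇Φ ≡ 0`, `H ≡ 0`, `e^{Φ} ≡ 1`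
  (Liouville's equation), `Φ ≡ 0` and `u ≡ 0` (the isometric Möbius datum);
* ★★ `LiouvilleCone.landau_of_shell` — if `U` contains a FULL SHELL `shell 0 r₁ r₂` (`0 < r₁ < r₂`) then on that shell EITHER `conicalField Φ ≡ 0`
  OR `conicalField Φ = landauAxisField a A` for a unit axis `a` and a parameter `A > 1` (Šverák's theorem read back through the correspondence);
* ★★ `LiouvilleCone.moebius_of_shell` — consequently, on the shell, EITHER `Φ ≡ 0` OR `Φ x = log ((A² − 1)|x|²/(A|x| − ⟪a, x⟫)²)`
  (= `LandauCone.potential a A x` of `…ConicalLandau.lean`, definitionally; read off `⟪x, u⟫ = 2e^{Φ} − 2`): A SOLUTION OF LIOUVILLE'S EQUATION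
  `−Δ_{S²}φ + 2 = 2e^{φ}` THAT IS REAL-ANALYTIC ON THE WHOLE SPHERE IS A MÖBIUS CONFORMAL FACTOR — in the kernel, through Navier–Stokes;
  so NON-axisymmetric Liouville data (K♯) are necessarily CONE-LOCAL (singular somewhere on every sphere about the vertex);
* ★ rider `eq_zero_of_isMinusOneHomogeneousOn_of_mem_ball` — the scale-invariant stratum on BALLS THROUGH THE CENTRE is EMPTY: a field
  differentiable on `ball x₁ ρ ∋ x₀` with Euler's identity `DV(x)(x − x₀) = −V(x)` there vanishes on the ball (ray constancy of
  `t ↦ t V(x₀ + t(x − x₀))` down to `t = 0`).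

PLACEMENT TABLE for the card's local rigidity statements on the `(−1)`-homogeneous stratum (director-ns g19 p100 (2)/p104): cone-ball / ball
not containing the centre — NON-RIGID (K♯ p719807/p721467; K♭ p717512); ball containing the centre — EMPTY (this rider); full shell about the
centre — LANDAU (`Homogeneous.landau_of_homogeneous` p711757; for conical data `landau_of_shell`); `ℝ³ ∖ {0}` — LANDAU (Šverák `_holds`) = exactly
the Möbius data (`LandauCone.liouvilleCone`, `…ConicalLandau.lean`).

HONEST FRAME: placement information strictly below W1; `SteadyShellRigidity` (C♯) off the homogeneous stratum, `PoloidalLiouville` (1222) and NS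
regularity are OPEN / NOT proved; 0 kit.

## References
* V. Šverák, On Landau's solutions of the Navier–Stokes equations, J. Math. Sci. 179 (2011) 208–228, arXiv:math/0604550, §1 Theorem 1, §4. [Sverak2011]
-/

-- the summit and its single sub-problem share the name (CONVENTIONS §1)
set_option linter.dupNamespace false

noncomputable section

namespace Summit.NavierStokesRegularity.NavierStokesRegularity.Theorems.PoloidalLiouville.AzimuthalCartan

open Set Function Filter Topology Metric
open scoped ContDiff RealInnerProductSpace
open Literature.Analysis.FluidPDE
open Summit.NavierStokesRegularity.NavierStokesRegularity.Theorems.PoloidalLiouville.CentreJet (E3 IsSteadyNSOn)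
open ConicalWitness (isSteadyNSOn_mono)

/-! ### Lagrange's identity and the kernel of `g ↦ g × x` on `x^⊥` -/

/-- LAGRANGE'S IDENTITY for the tree's `cross`: `|x|² |g|² = ⟪x, g⟫² + |g × x|²`. -/
theorem norm_sq_mul_norm_sq_eq_inner_sq_add (x g : E3) : ‖x‖ ^ 2 * ‖g‖ ^ 2 = ⟪x, g⟫ ^ 2 + ‖cross g x‖ ^ 2 := by
  simp only [EuclideanSpace.real_norm_sq_eq, Fin.sum_univ_three, PiLp.inner_apply, RCLike.inner_apply, conj_trivial]
  simp [cross, cross_apply]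
  ring

/-- A vector orthogonal to `x ≠ 0` and parallel to it (`g × x = 0`) vanishes. -/
theorem eq_zero_of_inner_eq_zero_of_cross_eq_zero {x g : E3} (hx : x ≠ 0) (hinner : ⟪x, g⟫ = 0) (hcross : cross g x = 0) : g = 0 := by
  have h := norm_sq_mul_norm_sq_eq_inner_sq_add x g
  rw [hinner, hcross, norm_zero] at h
  have hx' : ‖x‖ ^ 2 ≠ 0 := pow_ne_zero 2 (norm_ne_zero_iff.mpr hx)
  have hg : ‖g‖ ^ 2 = 0 := by
    have : ‖x‖ ^ 2 * ‖g‖ ^ 2 = 0 := by rw [h]; ring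
    exact (mul_eq_zero.mp this).resolve_left hx'
  exact norm_eq_zero.mp (pow_eq_zero_iff two_ne_zero |>.mp hg)

/-- The radial component of a Landau solution: `⟪x, U_{a,A}(x)⟫ = 2((A² − 1)|x|²/(A|x| − ⟪a, x⟫)² − 1)` (`x ≠ 0`; straight from the
Literature definition `landauAxisField`). -/
theorem inner_self_landauAxisField (a : E3) (A : ℝ) {x : E3} (hx : x ≠ 0) :
    ⟪x, landauAxisField a A x⟫ = 2 * ((A ^ 2 - 1) * ‖x‖ ^ 2 / (A * ‖x‖ - ⟪a, x⟫) ^ 2 - 1) := by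
  have hr : ‖x‖ ≠ 0 := norm_ne_zero_iff.mpr hx
  rw [landauAxisField, inner_add_right, inner_smul_right, inner_smul_right, inner_sub_right, inner_smul_right, real_inner_self_eq_norm_sq,
    real_inner_comm x a]
  field_simp
  ring

/-- Membership in a shell about `0` excludes the vertex (`0 < r₁`). -/
theorem ne_zero_of_mem_shell_zero {r₁ r₂ : ℝ} (hr₁ : 0 < r₁) {x : E3} (hx : x ∈ shell 0 r₁ r₂) : x ≠ 0 :=
  Homogeneous.ne_zero_of_mem_shell hr₁.le hx

namespace LiouvilleCone

variable {U : Set E3} {Φ : E3 → ℝ} {g : E3 → E3} {H : E3 → E3 →L[ℝ] E3} (hc : LiouvilleCone U Φ g H)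
include hc

/-! ### Where the vorticity vanishes the data are the isometric Möbius datum -/

/-- Where the vorticity of the conical flow vanishes, so does `∇Φ`: `curl u = (2e^{Φ}/|x|²)(g × x)` with a positive coefficient, and
`⟪x, g⟫ = 0` (Euler). -/
theorem grad_eq_zero_of_curl_eq_zero {x : E3} (hx : x ∈ U) (hcurl : curl (conicalField Φ) x = 0) : g x = 0 := by
  rw [hc.curl_conicalField hx] at hcurl
  have hcoef : 2 * Real.exp (Φ x) / ‖x‖ ^ 2 ≠ 0 := by
    have := hc.norm_sq_pos hx
    positivity
  have hcross : cross (g x) x = 0 := (smul_eq_zero.mp hcurl).resolve_left hcoef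
  exact eq_zero_of_inner_eq_zero_of_cross_eq_zero (hc.ne_zero x hx) (hc.euler x hx) hcross

/-- If the vorticity vanishes on an open `W ⊆ U` then on `W`: `H ≡ 0` (derivative of `g ≡ 0`), `e^{Φ} ≡ 1` (Liouville's equation), hence
`Φ ≡ 0` and the flow vanishes, `u = g + ((2e^{Φ} − 2)/|x|²) x ≡ 0`. -/
theorem conicalField_eq_zero_of_curl {W : Set E3} (hW : IsOpen W) (hWU : W ⊆ U) (hcurl : ∀ x ∈ W, curl (conicalField Φ) x = 0)
    {x : E3} (hx : x ∈ W) : Φ x = 0 ∧ conicalField Φ x = 0 := by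
  have hg : ∀ y ∈ W, g y = 0 := fun y hy => hc.grad_eq_zero_of_curl_eq_zero (hWU hy) (hcurl y hy)
  have hH : H x = 0 := by
    have h0 : HasFDerivAt g (0 : E3 →L[ℝ] E3) x := by
      refine (hasFDerivAt_const (0 : E3) x).congr_of_eventuallyEq ?_
      filter_upwards [hW.mem_nhds hx] with y hy using hg y hy
    exact (hc.hasFDerivAt_gradient x (hWU hx)).unique h0
  have hL := hc.liouville x (hWU hx)
  rw [hH] at hL
  simp only [zero_apply, PiLp.zero_apply, Finset.sum_const_zero, mul_zero, zero_add] at hL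
  have hexp : Real.exp (Φ x) = 1 := by linarith
  refine ⟨by simpa using congrArg Real.log hexp, ?_⟩
  rw [hc.conicalField_eq (hWU hx), hg x hx, radialCoeff, hexp]
  simp

/-! ### On a full shell: Landau or trivial -/

variable {r₁ r₂ : ℝ}

/-- ★★ **ŠVERÁK'S THEOREM READ BACK THROUGH THE CORRESPONDENCE.**  If the domain of the Liouville data contains a full shell
`r₁ < |x| < r₂` (`0 < r₁ < r₂`) about the vertex, then on that shell the conical flow is EITHER identically zero OR a Landau solution
`landauAxisField a A` (`‖a‖ = 1`, `A > 1`).  (Correspondence ⇒ analytic steady NS + `(−1)`-homogeneous on the shell; if `curl ≢ 0` there,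
`Homogeneous.landau_of_homogeneous`; if `curl ≡ 0` on the open shell, `conicalField_eq_zero_of_curl`.) -/
theorem landau_of_shell (hr₁ : 0 < r₁) (h₁₂ : r₁ < r₂) (hsub : shell 0 r₁ r₂ ⊆ U) :
    (∀ x ∈ shell 0 r₁ r₂, conicalField Φ x = 0) ∨
      ∃ a : E3, ‖a‖ = 1 ∧ ∃ A : ℝ, 1 < A ∧ ∀ x ∈ shell 0 r₁ r₂, conicalField Φ x = landauAxisField a A x := by
  by_cases hcurl : ∃ x ∈ shell 0 r₁ r₂, curl (conicalField Φ) x ≠ 0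
  · right
    obtain ⟨hV, hp, hNS, -, hhom, -⟩ := hc.correspondence
    obtain ⟨a, ha, A, hA, hL⟩ := Homogeneous.landau_of_homogeneous (x₀ := 0) (V := conicalField Φ) (p := conicalPressure Φ) hr₁ h₁₂
      (hV.mono hsub) (hp.mono hsub) (isSteadyNSOn_mono hNS hsub) hcurl (fun x hx => hhom x (hsub hx))
    exact ⟨a, ha, A, hA, fun x hx => by simpa using hL x hx⟩
  · left
    push Not at hcurl
    exact fun x hx => (hc.conicalField_eq_zero_of_curl (isOpen_shell 0 r₁ r₂) hsub hcurl hx).2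

/-- `⟪x, u(x)⟫ = 2e^{Φ} − 2`: the radial component of the conical flow reads the conformal factor (Euler kills `⟪x, ∇Φ⟫`). -/
theorem inner_self_conicalField {x : E3} (hx : x ∈ U) : ⟪x, conicalField Φ x⟫ = 2 * Real.exp (Φ x) - 2 := by
  have hr := hc.norm_ne_zero hx
  rw [hc.conicalField_eq hx, inner_add_right, inner_smul_right, hc.euler x hx, real_inner_self_eq_norm_sq, radialCoeff]
  field_simp
  ring

/-- ★★ **WHOLE-SPHERE SOLUTIONS OF LIOUVILLE'S EQUATION ARE MÖBIUS CONFORMAL FACTORS** (via Navier–Stokes).  If the domain of the Liouville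
data `|x|²ΔΦ + 2e^{Φ} − 2 = 0`, `⟪x, ∇Φ⟫ = 0` contains a full shell about the vertex, then on that shell EITHER `Φ ≡ 0` (the isometric
datum, flow `≡ 0`) OR `Φ(x) = log ((A² − 1)|x|²/(A|x| − ⟪a, x⟫)²)` for a unit axis `a` and `A > 1` — i.e. `e^{φ} = (A² − 1)/(A − cos θ)²` on the
sphere, the conformal factor of a Möbius map, and the flow is the Landau solution `landauAxisField a A` (`LandauCone.potential a A`,
`…ConicalLandau.lean`, definitionally). -/
theorem moebius_of_shell (hr₁ : 0 < r₁) (h₁₂ : r₁ < r₂) (hsub : shell 0 r₁ r₂ ⊆ U) :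
    (∀ x ∈ shell 0 r₁ r₂, Φ x = 0 ∧ conicalField Φ x = 0) ∨
      ∃ a : E3, ‖a‖ = 1 ∧ ∃ A : ℝ, 1 < A ∧ ∀ x ∈ shell 0 r₁ r₂,
        Φ x = Real.log ((A ^ 2 - 1) * ‖x‖ ^ 2 / (A * ‖x‖ - ⟪a, x⟫) ^ 2) ∧ conicalField Φ x = landauAxisField a A x := by
  by_cases hcurl : ∃ x ∈ shell 0 r₁ r₂, curl (conicalField Φ) x ≠ 0
  · right
    obtain ⟨hV, hp, hNS, -, hhom, -⟩ := hc.correspondence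
    obtain ⟨a, ha, A, hA, hL⟩ := Homogeneous.landau_of_homogeneous (x₀ := 0) (V := conicalField Φ) (p := conicalPressure Φ) hr₁ h₁₂
      (hV.mono hsub) (hp.mono hsub) (isSteadyNSOn_mono hNS hsub) hcurl (fun x hx => hhom x (hsub hx))
    refine ⟨a, ha, A, hA, fun x hx => ?_⟩
    have hLx : conicalField Φ x = landauAxisField a A x := by simpa using hL x hx
    refine ⟨?_, hLx⟩
    have h1 := hc.inner_self_conicalField (hsub hx)
    rw [hLx, inner_self_landauAxisField a A (ne_zero_of_mem_shell_zero hr₁ hx)] at h1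
    have hexp : Real.exp (Φ x) = (A ^ 2 - 1) * ‖x‖ ^ 2 / (A * ‖x‖ - ⟪a, x⟫) ^ 2 := by linarith
    rw [← hexp, Real.log_exp]
  · left
    push Not at hcurl
    exact fun x hx => hc.conicalField_eq_zero_of_curl (isOpen_shell 0 r₁ r₂) hsub hcurl hx

/-- The same for data on the WHOLE punctured space, shell by shell (`U = ℝ³ ∖ {0}` contains every shell about the vertex). -/
theorem moebius_of_punctured (hU : U = {x : E3 | x ≠ 0}) (hr₁ : 0 < r₁) (h₁₂ : r₁ < r₂) :
    (∀ x ∈ shell 0 r₁ r₂, Φ x = 0 ∧ conicalField Φ x = 0) ∨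
      ∃ a : E3, ‖a‖ = 1 ∧ ∃ A : ℝ, 1 < A ∧ ∀ x ∈ shell 0 r₁ r₂,
        Φ x = Real.log ((A ^ 2 - 1) * ‖x‖ ^ 2 / (A * ‖x‖ - ⟪a, x⟫) ^ 2) ∧ conicalField Φ x = landauAxisField a A x :=
  hc.moebius_of_shell hr₁ h₁₂ (fun _ hx => hU ▸ ne_zero_of_mem_shell_zero hr₁ hx)

end LiouvilleCone

/-! ### Rider: on balls THROUGH the centre the scale-invariant stratum is empty -/

/-- ★ **No `(−1)`-homogeneous flow on a ball containing its centre.**  If `V` is differentiable on `ball x₁ ρ ∋ x₀` and satisfies Euler's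
identity `DV(x)(x − x₀) = −V(x)` there (`IsMinusOneHomogeneousOn`), then `V ≡ 0` on the ball: along the segment from `x₀` to `x` (inside the
ball, convexity) the function `t ↦ t V(x₀ + t(x − x₀))` has derivative `V + DV·(t(x − x₀)) = 0`, so `V(x) = 0 · V(x₀) = 0`.  (So the card's local
statements posed on balls THROUGH the centre are vacuous on this stratum, while on balls off the centre / cone-balls it carries the
non-axisymmetric K♯ / K♭ flows and on full shells exactly the Landau flows.) -/
theorem eq_zero_of_isMinusOneHomogeneousOn_of_mem_ball {V : E3 → E3} {x₀ x₁ : E3} {ρ : ℝ} (hV : DifferentiableOn ℝ V (ball x₁ ρ))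
    (hhom : IsMinusOneHomogeneousOn (ball x₁ ρ) x₀ V) (hx₀ : x₀ ∈ ball x₁ ρ) {x : E3} (hx : x ∈ ball x₁ ρ) : V x = 0 := by
  -- the segment `γ t = x₀ + t (x − x₀)`, `t ∈ [0, 1]`, stays in the (convex) ball
  set γ : ℝ → E3 := fun t => x₀ + t • (x - x₀) with hγ_def
  have hγmem : ∀ t ∈ Icc (0 : ℝ) 1, γ t ∈ ball x₁ ρ := fun t ht => by
    have h := (convex_ball x₁ ρ).add_smul_sub_mem hx₀ hx ht
    simpa [hγ_def] using h
  have hγ' : ∀ t, HasDerivAt γ (x - x₀) t := fun t => by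
    have h := ((hasDerivAt_id t).smul_const (x - x₀)).const_add x₀
    simpa [hγ_def] using h
  -- `φ t = t • V (γ t)` has zero derivative on `[0, 1]`
  set φ : ℝ → E3 := fun t => t • V (γ t) with hφ_def
  have hφ' : ∀ t ∈ Icc (0 : ℝ) 1, HasDerivAt φ 0 t := fun t ht => by
    have hdV : HasFDerivAt V (fderiv ℝ V (γ t)) (γ t) :=
      (hV.differentiableAt (isOpen_ball.mem_nhds (hγmem t ht))).hasFDerivAt
    have hVγ : HasDerivAt (fun s => V (γ s)) (fderiv ℝ V (γ t) (x - x₀)) t := hdV.comp_hasDerivAt t (hγ' t)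
    have hφt : HasDerivAt φ (t • fderiv ℝ V (γ t) (x - x₀) + (1 : ℝ) • V (γ t)) t := (hasDerivAt_id' t).smul hVγ
    have heuler : fderiv ℝ V (γ t) (γ t - x₀) = -V (γ t) := hhom (γ t) (hγmem t ht)
    have hγt : γ t - x₀ = t • (x - x₀) := by simp [hγ_def]
    have hzero : t • fderiv ℝ V (γ t) (x - x₀) + (1 : ℝ) • V (γ t) = 0 := by
      rw [← ContinuousLinearMap.map_smul, ← hγt, heuler, one_smul, neg_add_cancel]
    exact hφt.congr_deriv hzero
  have hconst := constant_of_has_deriv_right_zero (f := φ) (a := 0) (b := 1)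
    (fun t ht => (hφ' t ht).continuousAt.continuousWithinAt) (fun t ht => (hφ' t ⟨ht.1, ht.2.le⟩).hasDerivWithinAt)
  have h1 := hconst 1 ⟨zero_le_one, le_rfl⟩
  simpa [hφ_def, hγ_def] using h1

end Summit.NavierStokesRegularity.NavierStokesRegularity.Theorems.PoloidalLiouville.AzimuthalCartan

end
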